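import Summits.HubbardSuperconductivity.HubbardSuperconductivity.Theorems.AnisotropyChordInsertionEntropySheetCluster
import Summits.HubbardSuperconductivity.HubbardSuperconductivity.Theorems.AnisotropyChordInsertionEntropySheetCovariance
import Mathlib.Analysis.Convex.SpecificFunctions.Basic

/-!
# Route `AnisotropyChord` / H0 rotor rung: the RESAMPLING ROUTE for a GENERAL Jastrow kernel — set-up, move
# identity and move inequality (kernel-generic port of theory seat `hubbard-h0-rotor-theory-1`, Sketch9 Part P,
# memo ROTOR-THEORY-9 §135(t) «kernel properties actually used (spec for generalisation, p1 g11)»)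

Setting: a finite abelian group `G` (e.g. the torus `(ℤ/L)²`), an even kernel `W : G → ℝ`, and the canonical
`N`-particle Jastrow / Rokhsar–Kivelson state `jAmp W N = jastrowSectorAmp (fun u v => W (u − v)) N` of
`…InsertionEntropyJastrowCanonical` (`|ψ|² ∝ e^{−½ Σ_{u,v} n_u n_v W(u−v)}·1[|σ| = N]`, normalised).
* `jPot W u σ = Σ_z W(z−u) n_z` (potential felt at `u`), `kernelMass W = Σ_t W t`, `jMeanPot W N = N·(Σ W)/|G|`;
  the two crux shapes of the resampling route: `JastrowEnergyFloor W N E` (Onsager-type energy floor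
  `Σ_occ Φ_u ≥ N(c − E)`) and `KernelPSDShift W D` (`W + Dδ` positive semidefinite);
* homogeneity of `jAmp` (translation invariance ⇒ constant density, symmetric pair masses), support, normalisation;
* amplitude-generic tools: `wcov_le_wmean_abs` (`cov(f,g) ≤ E|g − t|` for `0 ≤ f ≤ 1`), `wmean_mono_support`,
  the relabelling `sum_swap_move`, Jensen `mass_mul_exp_avg_le`, `|x| ≤ ±x + 2e^{∓x}`;
* **MOVE IDENTITY** `jAmp_sq_move`: for `u` occupied, `v` empty, `a(σ∘swap_{uv})² = a(σ)²·e^{−(Φ_v − Φ_u − W(u−v))}`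
  (needs only `W` even and `W 0 = 0`), and the **MOVE INEQUALITY** with an invariant non-negative factor
  `wsum_move_term_le_mul` (needs `W ≥ 0`): `Σ a² h n_u(1−n_v) e^{Φ_u−Φ_v} ≤ Σ a² h (1−n_u) n_v`.
-/

set_option linter.dupNamespace false

noncomputable section

open Finset

namespace Summit.HubbardSuperconductivity.HubbardSuperconductivity.Theorems.AnisotropyChord.InsertionEntropy

section GenericMove

variable {V : Type} [Fintype V] [DecidableEq V]

/-- `cov(f, g) ≤ E|g − t|` for an observable `f` with values in `[0,1]` and any constant `t` (`Z ≠ 0`).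
(theory seat Sketch9 Part P `cov_le_mean_abs`) [folklore] -/
theorem wcov_le_wmean_abs (a : (V → Fin 2) → ℝ) (f g : (V → Fin 2) → ℝ) (t : ℝ) (hZ : wnorm a ≠ 0)
    (hf0 : ∀ σ, 0 ≤ f σ) (hf1 : ∀ σ, f σ ≤ 1) :
    wcov a f g ≤ wmean a (fun σ => |g σ - t|) := by
  have hc : wcov a f g = wmean a (fun σ => (f σ - wmean a f) * (g σ - t)) := by
    have : (fun σ => (f σ - wmean a f) * (g σ - t))
        = fun σ => f σ * g σ + ((-t) * f σ + ((- wmean a f) * g σ + wmean a f * t)) := by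
      funext σ; ring
    rw [this, wmean_add, wmean_add, wmean_add, wmean_smul, wmean_smul, wmean_const a _ hZ]
    unfold wcov; ring
  rw [hc]
  refine wmean_mono a fun σ => ?_
  have hm0 : 0 ≤ wmean a f := wmean_nonneg a hf0
  have hm1 : wmean a f ≤ 1 := wmean_le_of_le a 1 hZ hf1
  have h1 : |f σ - wmean a f| ≤ 1 := by
    rw [abs_le]; constructor <;> linarith [hf0 σ, hf1 σ]
  calc (f σ - wmean a f) * (g σ - t) ≤ |(f σ - wmean a f) * (g σ - t)| := le_abs_self _
    _ = |f σ - wmean a f| * |g σ - t| := abs_mul _ _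
    _ ≤ 1 * |g σ - t| := mul_le_mul_of_nonneg_right h1 (abs_nonneg _)
    _ = |g σ - t| := one_mul _

/-- Monotonicity of `wmean` on the support of the amplitude. (theory seat Sketch9 Part P) [folklore] -/
theorem wmean_mono_support (a : (V → Fin 2) → ℝ) {f g : (V → Fin 2) → ℝ} (h : ∀ σ, a σ ≠ 0 → f σ ≤ g σ) :
    wmean a f ≤ wmean a g := by
  unfold wmean wsum
  refine div_le_div_of_nonneg_right (Finset.sum_le_sum fun σ _ => ?_) (wnorm_nonneg a)
  by_cases hσ : a σ = 0
  · rw [hσ]; simp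
  · exact mul_le_mul_of_nonneg_left (h σ hσ) (sq_nonneg _)

/-- `wmean` only sees the support of the amplitude. (theory seat Sketch9 Part P) [folklore] -/
theorem wmean_congr_support (a : (V → Fin 2) → ℝ) {f g : (V → Fin 2) → ℝ} (h : ∀ σ, a σ ≠ 0 → f σ = g σ) :
    wmean a f = wmean a g :=
  le_antisymm (wmean_mono_support a fun σ hσ => (h σ hσ).le) (wmean_mono_support a fun σ hσ => (h σ hσ).ge)

/-- Summing over the move `u → v` is a relabelling of configuration space:
`Σ_σ n_u (1 − n_v) g(σ ∘ swap_{uv}) = Σ_σ (1 − n_u) n_v g(σ)`. (theory seat Sketch9 Part P) [folklore] -/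
theorem sum_swap_move (g : (V → Fin 2) → ℝ) (u v : V) :
    ∑ σ : V → Fin 2, occ σ u * (1 - occ σ v) * g (σ ∘ Equiv.swap u v)
      = ∑ σ : V → Fin 2, (1 - occ σ u) * occ σ v * g σ := by
  rw [← Equiv.sum_comp (Equiv.arrowCongr (Equiv.swap u v) (Equiv.refl (Fin 2))).symm
    (fun σ : V → Fin 2 => occ σ u * (1 - occ σ v) * g (σ ∘ Equiv.swap u v))]
  refine Finset.sum_congr rfl fun σ _ => ?_
  have e : (Equiv.arrowCongr (Equiv.swap u v) (Equiv.refl (Fin 2))).symm σ = σ ∘ Equiv.swap u v := by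
    ext z; simp [Equiv.arrowCongr]
  rw [e]
  have hss : (σ ∘ Equiv.swap u v) ∘ Equiv.swap u v = σ := by
    funext z; simp [Equiv.swap_apply_self]
  have hu : occ (σ ∘ Equiv.swap u v) u = occ σ v := by
    unfold occ; simp [Equiv.swap_apply_left]
  have hv : occ (σ ∘ Equiv.swap u v) v = occ σ u := by
    unfold occ; simp [Equiv.swap_apply_right]
  rw [hss, hu, hv]; ring

/-- Relabelling with a swap-invariant factor: `Σ_σ n_u(1−n_v) h(σ) g(σ∘swap) = Σ_σ (1−n_u) n_v h(σ) g(σ)`.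
(theory seat Sketch9 Part P′) [folklore] -/
theorem sum_swap_move_mul (h g : (V → Fin 2) → ℝ) (u v : V) (hh : ∀ σ, h (σ ∘ Equiv.swap u v) = h σ) :
    ∑ σ : V → Fin 2, occ σ u * (1 - occ σ v) * (h σ * g (σ ∘ Equiv.swap u v))
      = ∑ σ : V → Fin 2, (1 - occ σ u) * occ σ v * (h σ * g σ) := by
  have := sum_swap_move (fun τ => h τ * g τ) u v
  simp only [hh] at this
  exact this

omit [Fintype V] in
/-- The move `u → v` (`u` occupied, `v` empty) as «remove at `u`, add at `v`». (theory seat Sketch9 Part P) [folklore] -/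
theorem swap_eq_update_update (σ : V → Fin 2) (u v : V) (huv : u ≠ v) (hu : σ u = 0) (hv : σ v = 1) :
    σ ∘ Equiv.swap u v = Function.update (Function.update σ u 1) v 0 := by
  funext z
  simp only [Function.comp_apply]
  by_cases hzu : z = u
  · subst hzu
    rw [Equiv.swap_apply_left, Function.update_of_ne huv, Function.update_self, hv]
  · by_cases hzv : z = v
    · subst hzv
      rw [Equiv.swap_apply_right, Function.update_self, hu]
    · rw [Equiv.swap_apply_of_ne_of_ne hzu hzv, Function.update_of_ne hzv, Function.update_of_ne hzu]

omit [Fintype V] in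
/-- Away from `u, v` the swap does not change occupations. (theory seat Sketch9 Part P′) [folklore] -/
theorem occ_comp_swap_of_ne (σ : V → Fin 2) (u v z : V) (hzu : z ≠ u) (hzv : z ≠ v) :
    occ (σ ∘ Equiv.swap u v) z = occ σ z := by
  unfold occ; simp [Function.comp_apply, Equiv.swap_apply_of_ne_of_ne hzu hzv]

/-- Jensen for `exp` with non-negative weights of total mass `k > 0`: `k · exp((Σ w x)/k) ≤ Σ w e^{x}`.
(theory seat Sketch9 Part P) [folklore] -/
theorem mass_mul_exp_avg_le {ι : Type} [Fintype ι] (w x : ι → ℝ) (k : ℝ) (hk : 0 < k)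
    (hw : ∀ i, 0 ≤ w i) (hsum : ∑ i, w i = k) :
    k * Real.exp ((∑ i, w i * x i) / k) ≤ ∑ i, w i * Real.exp (x i) := by
  have hJ := (convexOn_exp).map_sum_le (t := Finset.univ) (w := fun i => w i / k) (p := x)
    (fun i _ => div_nonneg (hw i) hk.le) (by rw [← Finset.sum_div, hsum, div_self hk.ne']) (fun i _ => Set.mem_univ _)
  simp only [smul_eq_mul] at hJ
  have h1 : (∑ i, w i / k * x i) = (∑ i, w i * x i) / k := by
    rw [Finset.sum_div]; exact Finset.sum_congr rfl fun i _ => by ring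
  have h2 : (∑ i, w i / k * Real.exp (x i)) = (∑ i, w i * Real.exp (x i)) / k := by
    rw [Finset.sum_div]; exact Finset.sum_congr rfl fun i _ => by ring
  rw [h1, h2, le_div_iff₀ hk] at hJ
  linarith

/-- `|x| ≤ x + 2e^{−x}`. [folklore] -/
theorem abs_le_self_add_two_exp_neg (x : ℝ) : |x| ≤ x + 2 * Real.exp (-x) := by
  rw [abs_le]; constructor
  · nlinarith [Real.add_one_le_exp (-x), Real.exp_pos (-x)]
  · linarith [Real.exp_pos (-x)]

/-- `|x| ≤ −x + 2e^{x}`. [folklore] -/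
theorem abs_le_neg_add_two_exp (x : ℝ) : |x| ≤ -x + 2 * Real.exp x := by
  have := abs_le_self_add_two_exp_neg (-x); rw [abs_neg, neg_neg] at this; exact this

/-- Jensen in the measure `μ` restricted by a non-negative factor `C`:
`mean(C) · exp(mean(C x)/mean(C)) ≤ mean(C e^{x})`. (theory seat Sketch9 Part P′ `mean_mul_exp_ge`) [folklore] -/
theorem wmean_mul_exp_ge (a : (V → Fin 2) → ℝ) (C x : (V → Fin 2) → ℝ) (hZ : 0 < wnorm a)
    (hC0 : ∀ σ, 0 ≤ C σ) (hmC : 0 < wmean a C) :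
    wmean a C * Real.exp (wmean a (fun σ => C σ * x σ) / wmean a C) ≤ wmean a (fun σ => C σ * Real.exp (x σ)) := by
  have hwC : 0 < wsum a C := by
    unfold wmean at hmC; exact (div_pos_iff_of_pos_right hZ).mp hmC
  have hJ := mass_mul_exp_avg_le (fun σ => a σ ^ 2 * C σ) x (wsum a C) hwC
    (fun σ => mul_nonneg (sq_nonneg _) (hC0 σ)) rfl
  have h1 : (∑ σ, a σ ^ 2 * C σ * x σ) = wsum a (fun σ => C σ * x σ) := by
    unfold wsum; exact Finset.sum_congr rfl fun σ _ => by ring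
  have h2 : (∑ σ, a σ ^ 2 * C σ * Real.exp (x σ)) = wsum a (fun σ => C σ * Real.exp (x σ)) := by
    unfold wsum; exact Finset.sum_congr rfl fun σ _ => by ring
  rw [h1, h2] at hJ
  have h3 : wsum a (fun σ => C σ * x σ) / wsum a C = wmean a (fun σ => C σ * x σ) / wmean a C := by
    unfold wmean; field_simp
  rw [h3] at hJ
  have h4 := div_le_div_of_nonneg_right hJ hZ.le
  have h5 : wmean a C * Real.exp (wmean a (fun σ => C σ * x σ) / wmean a C)
      = wsum a C * Real.exp (wmean a (fun σ => C σ * x σ) / wmean a C) / wnorm a := by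
    simp only [wmean]; ring
  rw [h5]; exact h4

end GenericMove

section Resampling

variable {G : Type} [AddCommGroup G] [Fintype G] [DecidableEq G]

/-- The canonical `N`-particle Jastrow / Rokhsar–Kivelson state with DIFFERENCE kernel `W`:
`jAmp W N = jastrowSectorAmp (fun u v => W (u − v)) N` (normalised, `N`-sector supported). [folklore] -/
def jAmp (W : G → ℝ) (N : ℕ) : (G → Fin 2) → ℝ := jastrowSectorAmp (fun u v => W (u - v)) N

/-- The potential felt at `u` from the particles of `σ`: `Φ_u(σ) = Σ_z W(z − u) n_z(σ)`. [folklore] -/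
def jPot (W : G → ℝ) (u : G) (σ : G → Fin 2) : ℝ := ∑ z, W (z - u) * occ σ z

/-- Total kernel mass `S = Σ_t W(t)`. [folklore] -/
def kernelMass (W : G → ℝ) : ℝ := ∑ t, W t

/-- Mean potential `c = N·S/|G|` of the `N`-particle sector. [folklore] -/
def jMeanPot (W : G → ℝ) (N : ℕ) : ℝ := (N : ℝ) * kernelMass W / (Fintype.card G : ℝ)

/-- **ENERGY FLOOR `JastrowEnergyFloor W N E`** (Onsager-type input): on the `N`-sector the potential summed over the
occupied sites is at least `N(c − E)`, `c = N S/|G|` the mean potential (`⟸ KernelPSDShift`, see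
`jastrowEnergyFloor_of_psd`). (theory seat Sketch9 Part P `SheetEnergyFloor`, generalised) [folklore] -/
def JastrowEnergyFloor (W : G → ℝ) (N : ℕ) (E : ℝ) : Prop :=
  ∀ σ : G → Fin 2, particleCount σ = N → (N : ℝ) * (jMeanPot W N - E) ≤ ∑ u, occ σ u * jPot W u σ

/-- **PSD INPUT `KernelPSDShift W D`:** the kernel `W(u−v) + D δ_{uv}` is positive semidefinite on `G`.
(theory seat Sketch9 Part P `SheetKernelPSD`, generalised) [folklore] -/
def KernelPSDShift (W : G → ℝ) (D : ℝ) : Prop :=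
  ∀ f : G → ℝ, 0 ≤ ∑ u, ∑ v, f u * f v * W (u - v) + D * ∑ u, f u ^ 2

/-- The canonical Jastrow state with a difference kernel is translation invariant. [folklore] -/
theorem jAmp_comp_addRight (W : G → ℝ) (N : ℕ) (t : G) (σ : G → Fin 2) :
    jAmp W N (σ ∘ Equiv.addRight t) = jAmp W N σ :=
  jastrowSectorAmp_comp_equiv _ N (Equiv.addRight t) (fun u v => by
    show W (u + t - (v + t)) = W (u - v)
    rw [add_sub_add_right_eq_sub]) σ

/-- Homogeneity of the site density. [folklore] -/
theorem siteDensity_jAmp_eq (W : G → ℝ) (N : ℕ) (x : G) :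
    siteDensity (jAmp W N) x = siteDensity (jAmp W N) 0 := by
  have h := siteDensity_comp_equiv (Equiv.addRight x) (jAmp W N) (jAmp_comp_addRight W N x) 0
  have h0 : (Equiv.addRight x) (0 : G) = x := by simp
  rw [h0] at h
  exact h

/-- Homogeneity in the `dens` currency. [folklore] -/
theorem dens_jAmp_const (W : G → ℝ) (N : ℕ) (z x : G) : dens (jAmp W N) z = dens (jAmp W N) x := by
  rw [dens_eq_siteDensity_div, dens_eq_siteDensity_div, siteDensity_jAmp_eq W N z, siteDensity_jAmp_eq W N x]

/-- Symmetric pair masses. [folklore] -/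
theorem pairMass_symm_jAmp (W : G → ℝ) (N : ℕ) (x y : G) :
    pairMass (jAmp W N) x y = pairMass (jAmp W N) y x :=
  pairMass_symm_of_siteDensity _ _ (siteDensity_jAmp_eq W N) x y

/-- The canonical Jastrow state is supported on the `N`-sector. [folklore] -/
theorem jAmp_support (W : G → ℝ) (N : ℕ) (σ : G → Fin 2) (h : jAmp W N σ ≠ 0) : particleCount σ = N :=
  particleCount_eq_of_jastrowSectorAmp_ne_zero _ N σ h

/-- Non-empty sector (`N ≤ |G|`). [folklore] -/
theorem jastrowSectorWeight_jAmp_pos (W : G → ℝ) (N : ℕ) (hN : N ≤ Fintype.card G) :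
    0 < jastrowSectorWeight (fun u v : G => W (u - v)) N :=
  jastrowSectorWeight_pos_of_le _ N hN

/-- `Z = Σ a² = 1` (`N ≤ |G|`). [folklore] -/
theorem wnorm_jAmp (W : G → ℝ) (N : ℕ) (hN : N ≤ Fintype.card G) : wnorm (jAmp W N) = 1 :=
  wnorm_jastrowSectorAmp _ N (jastrowSectorWeight_jAmp_pos W N hN)

/-- Every ordered pair admits a template (`1 ≤ N ≤ |G| − 1`). [folklore] -/
theorem pairMass_jAmp_pos (W : G → ℝ) (N : ℕ) (hN1 : 1 ≤ N) (hN2 : N + 1 ≤ Fintype.card G) (x y : G)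
    (hxy : x ≠ y) : 0 < pairMass (jAmp W N) x y :=
  pairMass_jastrowSectorAmp_pos _ N hN1 hN2 x y hxy

/-- On the support, `Σ_u n_u = N`. [folklore] -/
theorem sum_occ_jAmp (W : G → ℝ) (N : ℕ) (σ : G → Fin 2) (h : jAmp W N σ ≠ 0) : ∑ u, occ σ u = (N : ℝ) := by
  rw [sum_occ_eq_particleCount, jAmp_support W N σ h]

/-! ### The move identity and the move inequality -/

/-- After removing the particle at `u` (`σ = τ + u`), the potential felt at `x` is the spectator potential of `τ` plus
`W(u − x)`. [folklore] -/
theorem jPot_eq_spectatorField_add (W : G → ℝ) (τ : G → Fin 2) (u x : G) (hτu : τ u = 1) :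
    jPot W x (Function.update τ u 0) = spectatorField (fun p q => W (p - q)) τ x + W (u - x) := by
  unfold jPot spectatorField
  simp_rw [occ_update τ u hτu, mul_add, Finset.sum_add_distrib, mul_ite, mul_one, mul_zero]
  rw [Finset.sum_ite_eq' Finset.univ u]
  simp only [Finset.mem_univ, if_true]
  congr 1
  exact Finset.sum_congr rfl fun z _ => mul_comm _ _

/-- **MOVE IDENTITY for the unnormalised Jastrow weight:** for `u` occupied and `v` empty,
`ψ_w(σ∘swap_{uv})² = ψ_w(σ)² · exp(−(Φ_v(σ) − Φ_u(σ) − W(u−v)))` (`W` even, `W 0 = 0`).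
(theory seat Sketch9 Part P `halfSheetAmp_sq_move`) [folklore] -/
theorem jastrowAmp_sq_move (W : G → ℝ) (hWe : ∀ z, W (-z) = W z) (hW0 : W 0 = 0) (σ : G → Fin 2) (u v : G)
    (huv : u ≠ v) (hu : σ u = 0) (hv : σ v = 1) :
    jastrowAmp (fun p q => W (p - q)) (σ ∘ Equiv.swap u v) ^ 2
      = jastrowAmp (fun p q => W (p - q)) σ ^ 2 * Real.exp (-(jPot W v σ - jPot W u σ - W (u - v))) := by
  obtain ⟨τ, hτ⟩ : ∃ τ : G → Fin 2, τ = Function.update σ u 1 := ⟨_, rfl⟩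
  have hτu : τ u = 1 := by rw [hτ]; simp
  have hτv : τ v = 1 := by rw [hτ, Function.update_of_ne (Ne.symm huv)]; exact hv
  have hσ : Function.update τ u 0 = σ := by
    rw [hτ, Function.update_idem, ← hu, Function.update_eq_self]
  have hσ' : σ ∘ Equiv.swap u v = Function.update τ v 0 := by
    rw [swap_eq_update_update σ u v huv hu hv, hτ]
  have hw : ∀ p q : G, W (p - q) = W (q - p) := fun p q => by rw [← hWe (p - q), neg_sub]
  have hS : ∀ x, jPot W x σ = spectatorField (fun p q => W (p - q)) τ x + W (u - x) := by
    intro x; rw [← hσ]; exact jPot_eq_spectatorField_add W τ u x hτu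
  have hJσ : jastrowLogWeight (fun p q => W (p - q)) σ
      = jastrowLogWeight (fun p q => W (p - q)) τ + 2 * spectatorField (fun p q => W (p - q)) τ u := by
    have h := jastrowLogWeight_update (fun p q => W (p - q)) hw τ u hτu
    rw [hσ, sub_self, hW0, add_zero] at h
    exact h
  have hJσ' : jastrowLogWeight (fun p q => W (p - q)) (σ ∘ Equiv.swap u v)
      = jastrowLogWeight (fun p q => W (p - q)) τ + 2 * spectatorField (fun p q => W (p - q)) τ v := by
    have h := jastrowLogWeight_update (fun p q => W (p - q)) hw τ v hτv
    rw [← hσ', sub_self, hW0, add_zero] at h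
    exact h
  unfold jastrowAmp
  rw [hJσ', hJσ, hS v, hS u, sub_self, hW0, sq, ← Real.exp_add, sq, ← Real.exp_add, ← Real.exp_add]
  congr 1; ring

/-- **MOVE IDENTITY for the canonical state:** `a(σ∘swap_{uv})² = a(σ)² · exp(−(Φ_v(σ) − Φ_u(σ) − W(u−v)))` for
`u` occupied, `v` empty (`W` even, `W 0 = 0`). (theory seat Sketch9 Part P `halfSheetAmp_sq_move`) [folklore] -/
theorem jAmp_sq_move (W : G → ℝ) (hWe : ∀ z, W (-z) = W z) (hW0 : W 0 = 0) (N : ℕ) (σ : G → Fin 2) (u v : G)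
    (huv : u ≠ v) (hu : σ u = 0) (hv : σ v = 1) :
    jAmp W N (σ ∘ Equiv.swap u v) ^ 2
      = jAmp W N σ ^ 2 * Real.exp (-(jPot W v σ - jPot W u σ - W (u - v))) := by
  have hpc : particleCount (σ ∘ Equiv.swap u v) = particleCount σ := particleCount_comp_equiv _ σ
  unfold jAmp jastrowSectorAmp
  rw [hpc]
  by_cases hN : particleCount σ = N
  · rw [if_pos hN, if_pos hN, div_pow, div_pow, jastrowAmp_sq_move W hWe hW0 σ u v huv hu hv]
    ring
  · rw [if_neg hN, if_neg hN]; simp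

/-- **MOVE INEQUALITY with an invariant non-negative factor** (`W ≥ 0`; `u` occupied is moved to the empty `v`):
`Σ_σ a² h n_u(1−n_v) e^{Φ_u−Φ_v} ≤ Σ_σ a² h (1−n_u) n_v`. (theory seat Sketch9 Part P′ `wsum_move_term_le_mul`) [folklore] -/
theorem wsum_move_term_le_mul (W : G → ℝ) (hWe : ∀ z, W (-z) = W z) (hW0 : W 0 = 0) (hWnn : ∀ z, 0 ≤ W z)
    (N : ℕ) (u v : G) (h : (G → Fin 2) → ℝ) (hh : ∀ σ, h (σ ∘ Equiv.swap u v) = h σ) (h0 : ∀ σ, 0 ≤ h σ) :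
    ∑ σ, jAmp W N σ ^ 2 * (h σ * (occ σ u * (1 - occ σ v)) * Real.exp (jPot W u σ - jPot W v σ))
      ≤ ∑ σ, jAmp W N σ ^ 2 * (h σ * ((1 - occ σ u) * occ σ v)) := by
  by_cases huv : u = v
  · subst huv
    have h0' : ∀ σ : G → Fin 2, occ σ u * (1 - occ σ u) = 0 := fun σ => by
      unfold occ; split_ifs <;> ring
    have h0'' : ∀ σ : G → Fin 2, (1 - occ σ u) * occ σ u = 0 := fun σ => by
      unfold occ; split_ifs <;> ring
    simp_rw [h0', h0'', mul_zero, zero_mul, mul_zero, Finset.sum_const_zero]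
    exact le_rfl
  · calc ∑ σ, jAmp W N σ ^ 2 * (h σ * (occ σ u * (1 - occ σ v)) * Real.exp (jPot W u σ - jPot W v σ))
        ≤ ∑ σ, occ σ u * (1 - occ σ v) * (h σ * jAmp W N (σ ∘ Equiv.swap u v) ^ 2) := by
          refine Finset.sum_le_sum fun σ _ => ?_
          by_cases hc : σ u = 0 ∧ σ v = 1
          · rw [jAmp_sq_move W hWe hW0 N σ u v huv hc.1 hc.2]
            have hW : 0 ≤ W (u - v) := hWnn (u - v)
            have hocc : occ σ u * (1 - occ σ v) = 1 := by unfold occ; simp [hc.1, hc.2]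
            have hexp : Real.exp (jPot W u σ - jPot W v σ)
                ≤ Real.exp (-(jPot W v σ - jPot W u σ - W (u - v))) :=
              Real.exp_le_exp.mpr (by linarith)
            rw [hocc, mul_one, one_mul]
            have := mul_le_mul_of_nonneg_left hexp (mul_nonneg (sq_nonneg (jAmp W N σ)) (h0 σ))
            linarith [this]
          · have hocc : occ σ u * (1 - occ σ v) = 0 := by
              unfold occ
              by_cases hu : σ u = 0
              · have hv1 : ¬ σ v = 1 := fun hv => hc ⟨hu, hv⟩
                have hv0 : σ v = 0 := by
                  rcases Fin.exists_fin_two.mp ⟨σ v, rfl⟩ with e | e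
                  · exact e
                  · exact absurd e hv1
                simp [hu, hv0]
              · simp [hu]
            rw [show jAmp W N σ ^ 2 * (h σ * (occ σ u * (1 - occ σ v)) * Real.exp (jPot W u σ - jPot W v σ))
                = (occ σ u * (1 - occ σ v)) * (jAmp W N σ ^ 2 * h σ * Real.exp (jPot W u σ - jPot W v σ)) by ring,
              hocc]
            simp
      _ = ∑ σ, (1 - occ σ u) * occ σ v * (h σ * jAmp W N σ ^ 2) :=
          sum_swap_move_mul h (fun σ => jAmp W N σ ^ 2) u v hh
      _ = _ := Finset.sum_congr rfl fun σ _ => by ring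

/-- Termwise move bound (`W ≥ 0`): `Σ_σ a² n_u(1−n_v) e^{Φ_u − Φ_v} ≤ Σ_σ a² (1−n_u) n_v`.
(theory seat Sketch9 Part P `wsum_move_term_le`) [folklore] -/
theorem wsum_move_term_le (W : G → ℝ) (hWe : ∀ z, W (-z) = W z) (hW0 : W 0 = 0) (hWnn : ∀ z, 0 ≤ W z)
    (N : ℕ) (u v : G) :
    ∑ σ, jAmp W N σ ^ 2 * (occ σ u * (1 - occ σ v) * Real.exp (jPot W u σ - jPot W v σ))
      ≤ ∑ σ, jAmp W N σ ^ 2 * ((1 - occ σ u) * occ σ v) := by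
  have h := wsum_move_term_le_mul W hWe hW0 hWnn N u v (fun _ => 1) (fun _ => rfl) (fun _ => zero_le_one)
  simp only [one_mul] at h
  exact h

end Resampling

end Summit.HubbardSuperconductivity.HubbardSuperconductivity.Theorems.AnisotropyChord.InsertionEntropy
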